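import Literature.Analysis.FluidPDE.DuchonRobertUniformDefectOfEuler
import Literature.Analysis.FluidPDE.NovackKernelFamily
import HarnessLib

/-!
# Signed Euclidean kernel averages of space–time fields on the torus: `L^q` bounds and limits

Topic: Analysis/FluidPDE, tools for the kernel limit `γ → 0` in Novack's scale-`ℓ` longitudinal
balance (`Literature.Analysis.FluidPDE.NovackLongitudinalBalance`; M. Novack, *Scaling laws and
exact results in turbulence*, Nonlinearity 37 (2024) 095002, §2: "We first pass to the limit in
every term from (last:one) except the very last term … using the integrability assumptions on all
involved quantities and the dominated convergence theorem" — Step 1; "this choice may be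
justified by an application of the dominated convergence theorem" — Step 2).

The mollified objects of Novack's balances are Euclidean kernel averages
`(K f)(t,x) = ∫_{ℝ^d} K(ξ) f(t, x + πξ) dξ` of `L^q` fields on `(0,T) × T^d` through the covering
map `π`, with **signed**, bounded, compactly supported kernels `K` (entries of the tensor kernels
`T_• φ_{ℓ,γ}` and their differences), and the limit `γ → 0` replaces a smooth kernel by the sharp
one at fixed scale `ℓ`. This file provides, all **proved**:

* `Torus.integrable_kernel_mul_translate`, `Torus.aestronglyMeasurable_kernelAverage'`: the
  integrand `ξ ↦ K(ξ) f(x + πξ)` is integrable for `f ∈ L¹(T^d)` and the average is jointly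
  measurable;
* the **space–time Young bound** `Torus.lintegral_prod_enorm_kernelAverage_rpow_le`:
  `∫∫ |K f|^q ≤ (∫|K|)^q ∫∫ |f|^q` (`q ≥ 1`; the Jensen/Hölder step
  `(∫ w G)^q ≤ (∫ w)^{q−1} ∫ w G^q` is the tree's
  `Literature.Analysis.UnboundedOperators.lintegral_mul_rpow_le_of_one_le`, and
  `Torus.lintegral_enorm_kernelAverage_rpow_le` is the probability-kernel case);
* `Torus.convolution_periodize_apply`: the torus convolution with the periodisation of an even
  compactly supported continuous `g` **is** the kernel average, `(f ⋆ periodize g)(x) = ∫ g(ξ) f(x + πξ) dξ`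
  (the tree's `Torus.convolution_mollifierKernel_apply` is the mollifier case);
* `Torus.tendsto_lintegral_enorm_mul_sub_of_conj` (Hölder `a, b` conjugate: an `L^a` weight times
  fields converging in `L^b` converge in `L¹`) and its bounded-weight twin
  `Torus.tendsto_lintegral_enorm_mul_sub_of_bound`;
* the **master limit lemma** `Torus.tendsto_integral_mul_kernelAverage`: if the kernels `K_i` are
  uniformly bounded with supports in a fixed ball and `∫|K_i − K₀| → 0`, then for `f ∈ L^b` and a
  weight `w ∈ L^a` (`a, b` conjugate, or `w` bounded and `b = 1`),
  `∫∫ w · (K_i f) → ∫∫ w · (K₀ f)`.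

## References

* M. Novack, *Scaling laws and exact results in turbulence*, Nonlinearity 37 (2024) 095002,
  arXiv:2310.01375, §2 Step 1–2 (the limit `γ → 0` by dominated convergence). [Novack2024]
* G. B. Folland, *Real Analysis*, 2nd ed., Prop. 8.5, Thm. 6.18 (Young / Minkowski for
  integrals). [Folland1999]
-/

noncomputable section

open MeasureTheory MeasureTheory.Measure TopologicalSpace Set Function Filter Metric
open _root_.Topology
open scoped ENNReal NNReal Convolution InnerProductSpace RealInnerProductSpace

namespace Literature.Analysis.FluidPDE.Torus

variable {d : Type*} [Fintype d] [DecidableEq d]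

/-! ## The integrand of a signed kernel average -/

section Integrand

variable {F : Type*} [NormedAddCommGroup F] [NormedSpace ℝ F]

/-- **Integrability of the kernel-average integrand**: for `f ∈ L¹(T^d)`, a measurable kernel `K`
bounded by `C_K` with support in the closed ball of radius `R`, `ξ ↦ K(ξ) • f(x + πξ)` is
integrable on `ℝ^d` (the lift of an integrable function is integrable on bounded sets,
`Torus.integrableOn_lift_of_subset_closedBall`). [folklore] -/
theorem integrable_kernel_smul_translate {K : EuclideanSpace ℝ d → ℝ}
    (hKm : AEStronglyMeasurable K volume) {CK : ℝ} (hKb : ∀ ξ, ‖K ξ‖ ≤ CK) {R : ℝ}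
    (hKs : support K ⊆ closedBall 0 R) {f : UnitAddTorus d → F} (hf : Integrable f volume)
    (x : UnitAddTorus d) :
    Integrable (fun ξ => K ξ • f (x + FunctionSpaces.Torus.proj ξ)) volume := by
  have hfx : Integrable (fun y => f (x + y)) volume := hf.comp_add_left x
  have hlift : IntegrableOn (FunctionSpaces.Torus.lift fun y => f (x + y)) (closedBall 0 R) volume :=
    FunctionSpaces.Torus.integrableOn_lift_of_subset_closedBall hfx Subset.rfl
  have hKI : IntegrableOn (fun ξ => K ξ • f (x + FunctionSpaces.Torus.proj ξ)) (closedBall 0 R) volume :=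
    hlift.bdd_smul CK hKm.restrict (ae_of_all _ hKb)
  refine hKI.integrable_of_forall_notMem_eq_zero fun ξ hξ => ?_
  rw [notMem_support.1 fun h => hξ (hKs h), zero_smul]

omit [DecidableEq d] in
/-- Pointwise bound: `‖∫ K(ξ) • g(ξ) dξ‖ₑ ≤ ∫⁻ ‖K(ξ)‖ₑ ‖g(ξ)‖ₑ dξ`. [folklore] -/
theorem enorm_integral_kernel_smul_le (K : EuclideanSpace ℝ d → ℝ) (g : EuclideanSpace ℝ d → F) :
    ‖∫ ξ, K ξ • g ξ‖ₑ ≤ ∫⁻ ξ, ‖K ξ‖ₑ * ‖g ξ‖ₑ := by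
  refine (enorm_integral_le_lintegral_enorm _).trans (lintegral_mono fun ξ => ?_)
  rw [enorm_smul]

variable {T : ℝ}

omit [DecidableEq d] in
/-- Joint measurability of `((t,x), ξ) ↦ K(ξ) • f(t, x + πξ)` for measurable `K`. [folklore] -/
theorem aestronglyMeasurable_kernel_smul_translate {K : EuclideanSpace ℝ d → ℝ}
    (hKm : AEStronglyMeasurable K volume) {f : ℝ → UnitAddTorus d → F}
    (hf : AEStronglyMeasurable (uncurry f) ((volume.restrict (Ioo 0 T)).prod volume)) :
    AEStronglyMeasurable (fun q : (ℝ × UnitAddTorus d) × EuclideanSpace ℝ d =>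
        K q.2 • f q.1.1 (q.1.2 + FunctionSpaces.Torus.proj q.2))
      (((volume.restrict (Ioo 0 T)).prod volume).prod volume) :=
  (hKm.comp_snd).smul (aestronglyMeasurable_translate_proj hf)

omit [DecidableEq d] in
/-- **Measurability of signed kernel averages** on `(0,T) × T^d` (parametric Bochner integral of a
jointly measurable integrand). [folklore] -/
theorem aestronglyMeasurable_kernelAverage' {K : EuclideanSpace ℝ d → ℝ}
    (hKm : AEStronglyMeasurable K volume) {f : ℝ → UnitAddTorus d → F}
    (hf : AEStronglyMeasurable (uncurry f) ((volume.restrict (Ioo 0 T)).prod volume)) :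
    AEStronglyMeasurable (fun z : ℝ × UnitAddTorus d =>
        ∫ ξ, K ξ • f z.1 (z.2 + FunctionSpaces.Torus.proj ξ))
      ((volume.restrict (Ioo 0 T)).prod volume) :=
  (aestronglyMeasurable_kernel_smul_translate hKm hf).integral_prod_right'

end Integrand

/-! ## The space–time Young bound -/

section Young

variable {T : ℝ} {F : Type*} [NormedAddCommGroup F] [NormedSpace ℝ F]

omit [DecidableEq d] in
/-- **Space–time Young bound for signed kernel averages**: for a measurable kernel `K` with
`∫|K| < ∞`, a jointly measurable `f : (0,T) × T^d → F` and `q ≥ 1`,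
`∫∫ ‖∫ K(ξ) f(t, x + πξ) dξ‖^q ≤ (∫|K|)^q ∫∫ ‖f‖^q`
(pointwise `‖∫Kf‖ ≤ ∫|K||f|`, Jensen for the finite kernel `|K| dξ`, Tonelli and translation
invariance of Haar measure on `T^d`; Folland, Thm. 6.18). [folklore] -/
theorem lintegral_prod_enorm_kernelAverage_rpow_le {K : EuclideanSpace ℝ d → ℝ}
    (hKm : AEStronglyMeasurable K volume) (hKt : ∫⁻ ξ, ‖K ξ‖ₑ ≠ ⊤)
    {f : ℝ → UnitAddTorus d → F}
    (hf : AEStronglyMeasurable (uncurry f) ((volume.restrict (Ioo 0 T)).prod volume))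
    {q : ℝ} (hq : 1 ≤ q) :
    ∫⁻ z, ‖∫ ξ, K ξ • f z.1 (z.2 + FunctionSpaces.Torus.proj ξ)‖ₑ ^ q ∂((volume.restrict (Ioo 0 T)).prod volume) ≤
      (∫⁻ ξ, ‖K ξ‖ₑ) ^ q * ∫⁻ z, ‖uncurry f z‖ₑ ^ q ∂((volume.restrict (Ioo 0 T)).prod volume) := by
  have hq0 : 0 ≤ q := zero_le_one.trans hq
  set m := ∫⁻ ξ, ‖K ξ‖ₑ with hm
  have hwm : AEMeasurable (fun ξ => ‖K ξ‖ₑ) volume := hKm.enorm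
  have hDm := aestronglyMeasurable_translate_proj (T := T) hf
  have hsec : ∀ᵐ z ∂((volume.restrict (Ioo 0 T)).prod volume), AEStronglyMeasurable
      (fun ξ => f z.1 (z.2 + FunctionSpaces.Torus.proj ξ)) volume := hDm.prodMk_left
  -- pointwise Jensen
  have hpt : ∀ᵐ z ∂((volume.restrict (Ioo 0 T)).prod volume),
      ‖∫ ξ, K ξ • f z.1 (z.2 + FunctionSpaces.Torus.proj ξ)‖ₑ ^ q ≤
        m ^ (q - 1) * ∫⁻ ξ, ‖K ξ‖ₑ * ‖f z.1 (z.2 + FunctionSpaces.Torus.proj ξ)‖ₑ ^ q := by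
    filter_upwards [hsec] with z hzm
    exact (ENNReal.rpow_le_rpow (enorm_integral_kernel_smul_le K _) hq0).trans
      (UnboundedOperators.lintegral_mul_rpow_le_of_one_le hwm hzm.enorm hq)
  -- Tonelli
  have hK2 : AEStronglyMeasurable (fun p : (ℝ × UnitAddTorus d) × EuclideanSpace ℝ d => K p.2)
      (((volume.restrict (Ioo 0 T)).prod volume).prod volume) := hKm.comp_snd
  have hWG : AEMeasurable (uncurry fun (z : ℝ × UnitAddTorus d) (ξ : EuclideanSpace ℝ d) =>
      ‖K ξ‖ₑ * ‖f z.1 (z.2 + FunctionSpaces.Torus.proj ξ)‖ₑ ^ q)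
      (((volume.restrict (Ioo 0 T)).prod volume).prod volume) :=
    hK2.enorm.mul (hDm.enorm.pow_const q)
  refine (lintegral_mono_ae hpt).trans ?_
  rw [lintegral_const_mul'' (m ^ (q - 1)) (show AEMeasurable (fun z : ℝ × UnitAddTorus d =>
      ∫⁻ ξ, ‖K ξ‖ₑ * ‖f z.1 (z.2 + FunctionSpaces.Torus.proj ξ)‖ₑ ^ q)
      ((volume.restrict (Ioo 0 T)).prod volume) from hWG.lintegral_prod_right'),
    lintegral_lintegral_swap hWG]
  have e : ∀ ξ : EuclideanSpace ℝ d, ∫⁻ z, ‖K ξ‖ₑ * ‖f z.1 (z.2 + FunctionSpaces.Torus.proj ξ)‖ₑ ^ q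
      ∂((volume.restrict (Ioo 0 T)).prod volume) =
      ‖K ξ‖ₑ * ∫⁻ z, ‖uncurry f z‖ₑ ^ q ∂((volume.restrict (Ioo 0 T)).prod volume) := fun ξ => by
    rw [← lintegral_translate_enorm_rpow (f := f) (FunctionSpaces.Torus.proj ξ) q,
      ← lintegral_const_mul'' (‖K ξ‖ₑ) (show AEMeasurable (fun z : ℝ × UnitAddTorus d =>
        ‖f z.1 (z.2 + FunctionSpaces.Torus.proj ξ)‖ₑ ^ q) ((volume.restrict (Ioo 0 T)).prod volume) from
        ((aestronglyMeasurable_uncurry_comp_add hf _)).enorm.pow_const q)]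
  simp_rw [e]
  rw [lintegral_mul_const'' _ hwm, ← mul_assoc]
  gcongr
  -- `m^(q-1) * m ≤ m^q`
  by_cases hm0 : m = 0
  · rw [← hm, hm0, mul_zero]; exact zero_le
  · rw [← hm, show q = (q - 1) + 1 by ring, ENNReal.rpow_add _ _ hm0 hKt, ENNReal.rpow_one,
      add_sub_cancel_right]

end Young

/-! ## Torus convolution with a periodised even kernel as a kernel average -/

section Bridge

/-- **The torus convolution with a periodised even kernel is the Euclidean kernel average**: for
`f ∈ L¹(T^d)` and `g` continuous, even, supported in the closed ball of radius `R`,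
`(f ⋆ periodize g)(x) = ∫_{ℝ^d} g(ξ) f(x + πξ) dξ` (translation invariance, evenness and the
unfolding `Torus.integral_eq_integral_perSum_repr`; the tree's
`Torus.convolution_mollifierKernel_apply` is the mollifier case). [folklore] -/
theorem convolution_periodize_apply {g : EuclideanSpace ℝ d → ℝ} (hgc : Continuous g) {R : ℝ}
    (hgs : tsupport g ⊆ closedBall 0 R) (hge : ∀ ξ, g (-ξ) = g ξ) {f : UnitAddTorus d → ℝ}
    (hf : Integrable f volume) (x : UnitAddTorus d) :
    (f ⋆ FunctionSpaces.Torus.periodize g) x = ∫ ξ, g ξ * f (x + FunctionSpaces.Torus.proj ξ) := by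
  obtain ⟨Cg, hCg⟩ := (HasCompactSupport.of_support_subset_isCompact (isCompact_closedBall 0 R)
    ((subset_tsupport g).trans hgs)).exists_bound_of_continuous hgc
  -- `(f ⋆ K)(x) = ∫ K(z) f(x + z) dz`
  have h1 : (f ⋆ FunctionSpaces.Torus.periodize g) x =
      ∫ z, FunctionSpaces.Torus.periodize g z * f (x + z) := by
    rw [convolution_lsmul, ← integral_add_left_eq_self _ x]
    refine integral_congr_ae (ae_of_all _ fun z => ?_)
    simp only [smul_eq_mul]
    rw [show x - (x + z) = -z by abel, periodize_neg_of_even hge, mul_comm]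
  rw [h1]
  set G : EuclideanSpace ℝ d → ℝ := fun ξ => g ξ * f (x + FunctionSpaces.Torus.proj ξ) with hG
  have hGi : Integrable G volume :=
    integrable_kernel_smul_translate hgc.aestronglyMeasurable hCg ((subset_tsupport g).trans hgs) hf x
  have hGs : support G ⊆ closedBall 0 R := by
    refine fun ξ hξ => hgs (subset_tsupport _ fun h0 => hξ ?_)
    simp only [hG, h0, zero_mul]
  rw [show (∫ ξ, g ξ * f (x + FunctionSpaces.Torus.proj ξ)) = ∫ ξ, G ξ from rfl,
    FunctionSpaces.Torus.integral_eq_integral_perSum_repr hGi hGs]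
  refine integral_congr_ae (ae_of_all _ fun z => ?_)
  have hz : ‖FunctionSpaces.Torus.repr z‖ ≤ Fintype.card d :=
    FunctionSpaces.Torus.norm_le_card_of_mem_unitCube (FunctionSpaces.Torus.repr_mem_unitCube z)
  obtain ⟨n, hn⟩ := exists_nat_ge (R + Fintype.card d)
  dsimp only
  rw [FunctionSpaces.Torus.periodize_apply, FunctionSpaces.Torus.perSum_eq_sum hGs hz hn,
    FunctionSpaces.Torus.perSum_eq_sum ((subset_tsupport _).trans hgs) hz hn, Finset.sum_mul]
  refine Finset.sum_congr rfl fun k _ => ?_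
  simp only [hG, FunctionSpaces.Torus.proj_add_latticeVec, FunctionSpaces.Torus.proj_repr]

end Bridge

/-! ## Weighted `L¹` convergence from `L^b` convergence -/

section Holder

variable {X : Type*} [MeasurableSpace X] {μ : Measure X}

/-- **Weighted convergence, Hölder conjugate exponents**: if `∫ |w|^a < ∞` and
`∫ |Wᵢ − W₀|^b → 0` along a filter, `a, b > 1` conjugate, then `∫ |w Wᵢ − w W₀| → 0`
(the tree's `Torus.tendsto_lintegral_enorm_mul_sub` is the case `a = 3/2`, `b = 3`). [folklore] -/
theorem tendsto_lintegral_enorm_mul_sub_of_conj {ι : Type*} {l : Filter ι} {w : X → ℝ}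
    {W : ι → X → ℝ} {W₀ : X → ℝ} {a b : ℝ} (hab : a.HolderConjugate b)
    (hw : AEStronglyMeasurable w μ)
    (hW : ∀ᶠ i in l, AEStronglyMeasurable (fun x => W i x - W₀ x) μ)
    (hwa : ∫⁻ x, ‖w x‖ₑ ^ a ∂μ < ⊤)
    (hlim : Tendsto (fun i => ∫⁻ x, ‖W i x - W₀ x‖ₑ ^ b ∂μ) l (𝓝 0)) :
    Tendsto (fun i => ∫⁻ x, ‖w x * W i x - w x * W₀ x‖ₑ ∂μ) l (𝓝 0) := by
  have hb0 : 0 < b := hab.symm.pos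
  have hB : Tendsto (fun i => (∫⁻ x, ‖w x‖ₑ ^ a ∂μ) ^ (1 / a) *
      (∫⁻ x, ‖W i x - W₀ x‖ₑ ^ b ∂μ) ^ (1 / b)) l (𝓝 0) := by
    have h1 : Tendsto (fun i => (∫⁻ x, ‖W i x - W₀ x‖ₑ ^ b ∂μ) ^ (1 / b)) l (𝓝 0) := by
      have := ((ENNReal.continuous_rpow_const (y := 1 / b)).tendsto 0).comp hlim
      rwa [ENNReal.zero_rpow_of_pos (by positivity)] at this
    have h2 := ENNReal.Tendsto.const_mul h1 (a := (∫⁻ x, ‖w x‖ₑ ^ a ∂μ) ^ (1 / a))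
      (Or.inr (ENNReal.rpow_ne_top_of_nonneg (by positivity [hab.pos]) hwa.ne))
    rwa [mul_zero] at h2
  refine tendsto_of_tendsto_of_tendsto_of_le_of_le' tendsto_const_nhds hB
    (Eventually.of_forall fun _ => zero_le) ?_
  filter_upwards [hW] with i hi
  calc ∫⁻ x, ‖w x * W i x - w x * W₀ x‖ₑ ∂μ = ∫⁻ x, ‖w x‖ₑ * ‖W i x - W₀ x‖ₑ ∂μ := by
        refine lintegral_congr fun x => ?_
        rw [← mul_sub, enorm_mul]
    _ ≤ _ := ENNReal.lintegral_mul_le_Lp_mul_Lq μ hab hw.enorm hi.enorm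

/-- **Weighted convergence, bounded weight**: if `|w| ≤ C` and `∫ |Wᵢ − W₀| → 0` along a filter,
then `∫ |w Wᵢ − w W₀| → 0`. [folklore] -/
theorem tendsto_lintegral_enorm_mul_sub_of_bound {ι : Type*} {l : Filter ι} {w : X → ℝ}
    {W : ι → X → ℝ} {W₀ : X → ℝ} {C : ℝ} (hwb : ∀ x, ‖w x‖ ≤ C)
    (hlim : Tendsto (fun i => ∫⁻ x, ‖W i x - W₀ x‖ₑ ∂μ) l (𝓝 0)) :
    Tendsto (fun i => ∫⁻ x, ‖w x * W i x - w x * W₀ x‖ₑ ∂μ) l (𝓝 0) := by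
  have hB : Tendsto (fun i => ENNReal.ofReal C * ∫⁻ x, ‖W i x - W₀ x‖ₑ ∂μ) l (𝓝 0) := by
    have h2 := ENNReal.Tendsto.const_mul hlim (a := ENNReal.ofReal C) (Or.inr ENNReal.ofReal_ne_top)
    rwa [mul_zero] at h2
  refine tendsto_of_tendsto_of_tendsto_of_le_of_le' tendsto_const_nhds hB
    (Eventually.of_forall fun _ => zero_le) (Eventually.of_forall fun i => ?_)
  rw [← lintegral_const_mul' _ _ ENNReal.ofReal_ne_top]
  refine lintegral_mono fun x => ?_
  rw [← mul_sub, enorm_mul]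
  gcongr
  rw [← ofReal_norm]
  exact ENNReal.ofReal_le_ofReal (hwb x)

/-- **Hölder integrability, conjugate exponents**: `w W` is integrable for `∫ |w|^a < ∞`,
`∫ |W|^b < ∞`, `a, b` conjugate (the tree's `Torus.integrable_mul_of_lintegral_rpow` is the case
`3/2, 3`). [folklore] -/
theorem integrable_mul_of_conj {w W : X → ℝ} {a b : ℝ} (hab : a.HolderConjugate b)
    (hw : AEStronglyMeasurable w μ) (hW : AEStronglyMeasurable W μ)
    (hwa : ∫⁻ x, ‖w x‖ₑ ^ a ∂μ < ⊤) (hWb : ∫⁻ x, ‖W x‖ₑ ^ b ∂μ < ⊤) :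
    Integrable (fun x => w x * W x) μ := by
  refine ⟨hw.mul hW, ?_⟩
  calc ∫⁻ x, ‖w x * W x‖ₑ ∂μ = ∫⁻ x, ‖w x‖ₑ * ‖W x‖ₑ ∂μ := lintegral_congr fun x => enorm_mul _ _
    _ ≤ (∫⁻ x, ‖w x‖ₑ ^ a ∂μ) ^ (1 / a) * (∫⁻ x, ‖W x‖ₑ ^ b ∂μ) ^ (1 / b) :=
        ENNReal.lintegral_mul_le_Lp_mul_Lq μ hab hw.enorm hW.enorm
    _ < ⊤ := ENNReal.mul_lt_top (ENNReal.rpow_lt_top_of_nonneg (by positivity [hab.pos]) hwa.ne)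
        (ENNReal.rpow_lt_top_of_nonneg (by positivity [hab.symm.pos]) hWb.ne)

end Holder

/-! ## The master limit lemma: kernels converging in `L¹` -/

section Master

variable {T : ℝ}

omit [DecidableEq d] in
/-- A measurable kernel bounded by `C_K` with support in the closed ball of radius `R` has finite
`L¹` norm. [folklore] -/
theorem lintegral_enorm_kernel_lt_top {K : EuclideanSpace ℝ d → ℝ} {CK : ℝ} (hKb : ∀ ξ, ‖K ξ‖ ≤ CK)
    {R : ℝ} (hKs : support K ⊆ closedBall 0 R) : ∫⁻ ξ, ‖K ξ‖ₑ < ⊤ := by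
  have hle : ∀ ξ, ‖K ξ‖ₑ ≤ (closedBall (0 : EuclideanSpace ℝ d) R).indicator (fun _ => ENNReal.ofReal CK) ξ := by
    intro ξ
    by_cases hξ : ξ ∈ closedBall (0 : EuclideanSpace ℝ d) R
    · rw [indicator_of_mem hξ, ← ofReal_norm]
      exact ENNReal.ofReal_le_ofReal (hKb ξ)
    · rw [indicator_of_notMem hξ, notMem_support.1 fun h => hξ (hKs h), enorm_zero]
  calc ∫⁻ ξ, ‖K ξ‖ₑ ≤ ∫⁻ ξ, (closedBall (0 : EuclideanSpace ℝ d) R).indicator (fun _ => ENNReal.ofReal CK) ξ :=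
        lintegral_mono hle
    _ = ENNReal.ofReal CK * volume (closedBall (0 : EuclideanSpace ℝ d) R) :=
        lintegral_indicator_const measurableSet_closedBall _
    _ < ⊤ := ENNReal.mul_lt_top ENNReal.ofReal_lt_top measure_closedBall_lt_top

/-- **Kernel averages at a.e. point: difference of kernels.** For `f` with integrable slices and
two bounded measurable kernels supported in a fixed ball, a.e. on `(0,T) × T^d`
`∫ K₁ f(·+πξ) − ∫ K₂ f(·+πξ) = ∫ (K₁ − K₂) f(·+πξ)`. [folklore] -/
theorem ae_kernelAverage_sub {K₁ K₂ : EuclideanSpace ℝ d → ℝ}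
    (h1m : AEStronglyMeasurable K₁ volume) (h2m : AEStronglyMeasurable K₂ volume) {CK : ℝ}
    (h1b : ∀ ξ, ‖K₁ ξ‖ ≤ CK) (h2b : ∀ ξ, ‖K₂ ξ‖ ≤ CK) {R : ℝ}
    (h1s : support K₁ ⊆ closedBall 0 R) (h2s : support K₂ ⊆ closedBall 0 R)
    {f : ℝ → UnitAddTorus d → ℝ}
    (hfi : ∀ᵐ t ∂(volume.restrict (Ioo 0 T)), Integrable (f t) volume) :
    ∀ᵐ z ∂((volume.restrict (Ioo 0 T)).prod (volume : Measure (UnitAddTorus d))),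
      (∫ ξ, K₁ ξ * f z.1 (z.2 + FunctionSpaces.Torus.proj ξ)) -
          ∫ ξ, K₂ ξ * f z.1 (z.2 + FunctionSpaces.Torus.proj ξ) =
        ∫ ξ, (K₁ ξ - K₂ ξ) * f z.1 (z.2 + FunctionSpaces.Torus.proj ξ) := by
  filter_upwards [(quasiMeasurePreserving_fst (μ := volume.restrict (Ioo 0 T))
    (ν := (volume : Measure (UnitAddTorus d)))).ae hfi] with z hz
  have i1 := integrable_kernel_smul_translate h1m h1b h1s hz z.2
  have i2 := integrable_kernel_smul_translate h2m h2b h2s hz z.2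
  simp only [smul_eq_mul] at i1 i2
  rw [← integral_sub i1 i2]
  exact integral_congr_ae (ae_of_all _ fun ξ => by ring)

/-- **Master limit lemma, Hölder-conjugate weight** (the engine of Novack's "pass to the limit
`γ → 0` … by the dominated convergence theorem", §2 Step 1–2, in `L^a × L^b` form): let the
measurable kernels `Kᵢ`, `K₀` on `ℝ^d` be bounded by `C_K` with supports in the closed ball of
radius `R`, and `∫ |Kᵢ − K₀| → 0` along a filter `l`; let `f ∈ L^b((0,T) × T^d)` be jointly
measurable with integrable slices and `w ∈ L^a((0,T) × T^d)`, `a, b` conjugate. Then the weighted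
kernel averages converge:
`∫∫ w(t,x) ∫ Kᵢ(ξ) f(t, x + πξ) dξ → ∫∫ w(t,x) ∫ K₀(ξ) f(t, x + πξ) dξ`, all pairings being
honest integrals. [cite: Novack2024, Sect. 2 Step 2, limit γ → 0 (dominated convergence)] -/
theorem tendsto_integral_mul_kernelAverage_of_conj {ι : Type*} {l : Filter ι}
    {K : ι → EuclideanSpace ℝ d → ℝ} {K₀ : EuclideanSpace ℝ d → ℝ}
    (hKm : ∀ i, AEStronglyMeasurable (K i) volume) (hK₀m : AEStronglyMeasurable K₀ volume)
    {CK : ℝ} (hKb : ∀ i ξ, ‖K i ξ‖ ≤ CK) (hK₀b : ∀ ξ, ‖K₀ ξ‖ ≤ CK)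
    {R : ℝ} (hKs : ∀ i, support (K i) ⊆ closedBall 0 R) (hK₀s : support K₀ ⊆ closedBall 0 R)
    (hKlim : Tendsto (fun i => ∫⁻ ξ, ‖K i ξ - K₀ ξ‖ₑ) l (𝓝 0))
    {f : ℝ → UnitAddTorus d → ℝ}
    (hf : AEStronglyMeasurable (uncurry f) ((volume.restrict (Ioo 0 T)).prod volume))
    (hfi : ∀ᵐ t ∂(volume.restrict (Ioo 0 T)), Integrable (f t) volume)
    {a b : ℝ} (hab : a.HolderConjugate b)
    (hfb : ∫⁻ z, ‖uncurry f z‖ₑ ^ b ∂((volume.restrict (Ioo 0 T)).prod volume) < ⊤)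
    {w : ℝ × UnitAddTorus d → ℝ} (hw : AEStronglyMeasurable w ((volume.restrict (Ioo 0 T)).prod volume))
    (hwa : ∫⁻ z, ‖w z‖ₑ ^ a ∂((volume.restrict (Ioo 0 T)).prod volume) < ⊤) :
    Integrable (fun z => w z * ∫ ξ, K₀ ξ * f z.1 (z.2 + FunctionSpaces.Torus.proj ξ))
        ((volume.restrict (Ioo 0 T)).prod volume) ∧
      (∀ i, Integrable (fun z => w z * ∫ ξ, K i ξ * f z.1 (z.2 + FunctionSpaces.Torus.proj ξ))
        ((volume.restrict (Ioo 0 T)).prod volume)) ∧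
      Tendsto (fun i => ∫ z, w z * (∫ ξ, K i ξ * f z.1 (z.2 + FunctionSpaces.Torus.proj ξ))
          ∂((volume.restrict (Ioo 0 T)).prod volume)) l
        (𝓝 (∫ z, w z * (∫ ξ, K₀ ξ * f z.1 (z.2 + FunctionSpaces.Torus.proj ξ))
          ∂((volume.restrict (Ioo 0 T)).prod volume))) := by
  set μT := (volume.restrict (Ioo 0 T)).prod (volume : Measure (UnitAddTorus d)) with hμT
  have hb1 : 1 ≤ b := hab.symm.lt.le
  have hb0 : 0 < b := hab.symm.pos
  -- the averages as measurable fields, and their `L^b` bounds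
  set A : ι → ℝ × UnitAddTorus d → ℝ := fun i z =>
    ∫ ξ : EuclideanSpace ℝ d, K i ξ * f z.1 (z.2 + FunctionSpaces.Torus.proj ξ) with hA
  set A₀ : ℝ × UnitAddTorus d → ℝ := fun z =>
    ∫ ξ : EuclideanSpace ℝ d, K₀ ξ * f z.1 (z.2 + FunctionSpaces.Torus.proj ξ) with hA₀
  have hAm : ∀ i, AEStronglyMeasurable (A i) μT := fun i => by
    simpa only [smul_eq_mul] using aestronglyMeasurable_kernelAverage' (T := T) (hKm i) hf
  have hA₀m : AEStronglyMeasurable A₀ μT := by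
    simpa only [smul_eq_mul] using aestronglyMeasurable_kernelAverage' (T := T) hK₀m hf
  have hbound : ∀ {G : EuclideanSpace ℝ d → ℝ}, AEStronglyMeasurable G volume → ∫⁻ ξ, ‖G ξ‖ₑ ≠ ⊤ →
      ∫⁻ z, ‖∫ ξ, G ξ * f z.1 (z.2 + FunctionSpaces.Torus.proj ξ)‖ₑ ^ b ∂μT ≤
        (∫⁻ ξ, ‖G ξ‖ₑ) ^ b * ∫⁻ z, ‖uncurry f z‖ₑ ^ b ∂μT := fun hGm hGt => by
    simpa only [smul_eq_mul] using lintegral_prod_enorm_kernelAverage_rpow_le (T := T) hGm hGt hf hb1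
  have hKt : ∀ i, ∫⁻ ξ, ‖K i ξ‖ₑ < ⊤ := fun i => lintegral_enorm_kernel_lt_top (hKb i) (hKs i)
  have hK₀t : ∫⁻ ξ, ‖K₀ ξ‖ₑ < ⊤ := lintegral_enorm_kernel_lt_top hK₀b hK₀s
  have hAb : ∀ i, ∫⁻ z, ‖A i z‖ₑ ^ b ∂μT < ⊤ := fun i =>
    lt_of_le_of_lt (hbound (hKm i) (hKt i).ne)
      (ENNReal.mul_lt_top (ENNReal.rpow_lt_top_of_nonneg hb0.le (hKt i).ne) hfb)
  have hA₀b : ∫⁻ z, ‖A₀ z‖ₑ ^ b ∂μT < ⊤ :=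
    lt_of_le_of_lt (hbound hK₀m hK₀t.ne)
      (ENNReal.mul_lt_top (ENNReal.rpow_lt_top_of_nonneg hb0.le hK₀t.ne) hfb)
  -- integrability of the pairings
  have hI₀ : Integrable (fun z => w z * A₀ z) μT := integrable_mul_of_conj hab hw hA₀m hwa hA₀b
  have hI : ∀ i, Integrable (fun z => w z * A i z) μT := fun i =>
    integrable_mul_of_conj hab hw (hAm i) hwa (hAb i)
  refine ⟨hI₀, hI, ?_⟩
  -- `L^b` convergence of the averages
  have hdev : Tendsto (fun i => ∫⁻ z, ‖A i z - A₀ z‖ₑ ^ b ∂μT) l (𝓝 0) := by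
    have hD : ∀ i, ∫⁻ z, ‖A i z - A₀ z‖ₑ ^ b ∂μT ≤
        (∫⁻ ξ, ‖K i ξ - K₀ ξ‖ₑ) ^ b * ∫⁻ z, ‖uncurry f z‖ₑ ^ b ∂μT := by
      intro i
      have hdiff := ae_kernelAverage_sub (T := T) (hKm i) hK₀m (hKb i) hK₀b (hKs i) hK₀s hfi
      have hDt : ∫⁻ ξ, ‖K i ξ - K₀ ξ‖ₑ ≠ ⊤ := by
        refine (lt_of_le_of_lt (lintegral_mono fun ξ => enorm_sub_le) ?_).ne
        rw [lintegral_add_left' (hKm i).enorm]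
        exact ENNReal.add_lt_top.2 ⟨hKt i, hK₀t⟩
      calc ∫⁻ z, ‖A i z - A₀ z‖ₑ ^ b ∂μT
          = ∫⁻ z, ‖∫ ξ, (K i ξ - K₀ ξ) * f z.1 (z.2 + FunctionSpaces.Torus.proj ξ)‖ₑ ^ b ∂μT :=
            lintegral_congr_ae (hdiff.mono fun z hz => by rw [hA, hA₀]; dsimp only; rw [hz])
        _ ≤ _ := hbound ((hKm i).sub hK₀m) hDt
    have hlim : Tendsto (fun i => (∫⁻ ξ, ‖K i ξ - K₀ ξ‖ₑ) ^ b * ∫⁻ z, ‖uncurry f z‖ₑ ^ b ∂μT) l (𝓝 0) := by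
      have h1 : Tendsto (fun i => (∫⁻ ξ, ‖K i ξ - K₀ ξ‖ₑ) ^ b) l (𝓝 0) := by
        have := ((ENNReal.continuous_rpow_const (y := b)).tendsto 0).comp hKlim
        rwa [ENNReal.zero_rpow_of_pos hb0] at this
      have h2 := ENNReal.Tendsto.mul_const h1 (b := ∫⁻ z, ‖uncurry f z‖ₑ ^ b ∂μT) (Or.inr hfb.ne)
      rwa [zero_mul] at h2
    exact tendsto_of_tendsto_of_tendsto_of_le_of_le' tendsto_const_nhds hlim
      (Eventually.of_forall fun _ => zero_le) (Eventually.of_forall hD)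
  -- weighted `L¹` convergence and the limit of the integrals
  have hL1 := tendsto_lintegral_enorm_mul_sub_of_conj hab hw
    (Eventually.of_forall fun i => (hAm i).sub hA₀m) hwa hdev
  exact tendsto_integral_of_L1 (fun z => w z * A₀ z) hI₀.aestronglyMeasurable (Eventually.of_forall hI) hL1

/-- **Master limit lemma, bounded weight** (`b = 1`): under the kernel hypotheses of
`tendsto_integral_mul_kernelAverage_of_conj`, for `f ∈ L¹((0,T) × T^d)` jointly measurable with
integrable slices and a bounded measurable weight `w`,
`∫∫ w ∫ Kᵢ f(·+πξ) → ∫∫ w ∫ K₀ f(·+πξ)`. [cite: Novack2024, Sect. 2 Step 2, limit γ → 0 (dominated convergence)] -/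
theorem tendsto_integral_mul_kernelAverage_of_bound {ι : Type*} {l : Filter ι}
    {K : ι → EuclideanSpace ℝ d → ℝ} {K₀ : EuclideanSpace ℝ d → ℝ}
    (hKm : ∀ i, AEStronglyMeasurable (K i) volume) (hK₀m : AEStronglyMeasurable K₀ volume)
    {CK : ℝ} (hKb : ∀ i ξ, ‖K i ξ‖ ≤ CK) (hK₀b : ∀ ξ, ‖K₀ ξ‖ ≤ CK)
    {R : ℝ} (hKs : ∀ i, support (K i) ⊆ closedBall 0 R) (hK₀s : support K₀ ⊆ closedBall 0 R)
    (hKlim : Tendsto (fun i => ∫⁻ ξ, ‖K i ξ - K₀ ξ‖ₑ) l (𝓝 0))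
    {f : ℝ → UnitAddTorus d → ℝ}
    (hf : AEStronglyMeasurable (uncurry f) ((volume.restrict (Ioo 0 T)).prod volume))
    (hfi : ∀ᵐ t ∂(volume.restrict (Ioo 0 T)), Integrable (f t) volume)
    (hf1 : ∫⁻ z, ‖uncurry f z‖ₑ ∂((volume.restrict (Ioo 0 T)).prod volume) < ⊤)
    {w : ℝ × UnitAddTorus d → ℝ} (hw : AEStronglyMeasurable w ((volume.restrict (Ioo 0 T)).prod volume))
    {Cw : ℝ} (hwb : ∀ z, ‖w z‖ ≤ Cw) :
    Integrable (fun z => w z * ∫ ξ, K₀ ξ * f z.1 (z.2 + FunctionSpaces.Torus.proj ξ))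
        ((volume.restrict (Ioo 0 T)).prod volume) ∧
      (∀ i, Integrable (fun z => w z * ∫ ξ, K i ξ * f z.1 (z.2 + FunctionSpaces.Torus.proj ξ))
        ((volume.restrict (Ioo 0 T)).prod volume)) ∧
      Tendsto (fun i => ∫ z, w z * (∫ ξ, K i ξ * f z.1 (z.2 + FunctionSpaces.Torus.proj ξ))
          ∂((volume.restrict (Ioo 0 T)).prod volume)) l
        (𝓝 (∫ z, w z * (∫ ξ, K₀ ξ * f z.1 (z.2 + FunctionSpaces.Torus.proj ξ))
          ∂((volume.restrict (Ioo 0 T)).prod volume))) := by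
  set μT := (volume.restrict (Ioo 0 T)).prod (volume : Measure (UnitAddTorus d)) with hμT
  set A : ι → ℝ × UnitAddTorus d → ℝ := fun i z =>
    ∫ ξ : EuclideanSpace ℝ d, K i ξ * f z.1 (z.2 + FunctionSpaces.Torus.proj ξ) with hA
  set A₀ : ℝ × UnitAddTorus d → ℝ := fun z =>
    ∫ ξ : EuclideanSpace ℝ d, K₀ ξ * f z.1 (z.2 + FunctionSpaces.Torus.proj ξ) with hA₀
  have hAm : ∀ i, AEStronglyMeasurable (A i) μT := fun i => by
    simpa only [smul_eq_mul] using aestronglyMeasurable_kernelAverage' (T := T) (hKm i) hf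
  have hA₀m : AEStronglyMeasurable A₀ μT := by
    simpa only [smul_eq_mul] using aestronglyMeasurable_kernelAverage' (T := T) hK₀m hf
  have hbound : ∀ {G : EuclideanSpace ℝ d → ℝ}, AEStronglyMeasurable G volume → ∫⁻ ξ, ‖G ξ‖ₑ ≠ ⊤ →
      ∫⁻ z, ‖∫ ξ, G ξ * f z.1 (z.2 + FunctionSpaces.Torus.proj ξ)‖ₑ ∂μT ≤
        (∫⁻ ξ, ‖G ξ‖ₑ) * ∫⁻ z, ‖uncurry f z‖ₑ ∂μT := fun hGm hGt => by
    have h := lintegral_prod_enorm_kernelAverage_rpow_le (T := T) hGm hGt hf le_rfl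
    simpa only [smul_eq_mul, ENNReal.rpow_one] using h
  have hKt : ∀ i, ∫⁻ ξ, ‖K i ξ‖ₑ < ⊤ := fun i => lintegral_enorm_kernel_lt_top (hKb i) (hKs i)
  have hK₀t : ∫⁻ ξ, ‖K₀ ξ‖ₑ < ⊤ := lintegral_enorm_kernel_lt_top hK₀b hK₀s
  have hAi : ∀ i, Integrable (A i) μT := fun i =>
    ⟨hAm i, lt_of_le_of_lt (hbound (hKm i) (hKt i).ne) (ENNReal.mul_lt_top (hKt i) hf1)⟩
  have hA₀i : Integrable A₀ μT :=
    ⟨hA₀m, lt_of_le_of_lt (hbound hK₀m hK₀t.ne) (ENNReal.mul_lt_top hK₀t hf1)⟩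
  have hI₀ : Integrable (fun z => w z * A₀ z) μT := hA₀i.bdd_mul hw (ae_of_all _ hwb)
  have hI : ∀ i, Integrable (fun z => w z * A i z) μT := fun i => (hAi i).bdd_mul hw (ae_of_all _ hwb)
  refine ⟨hI₀, hI, ?_⟩
  have hdev : Tendsto (fun i => ∫⁻ z, ‖A i z - A₀ z‖ₑ ∂μT) l (𝓝 0) := by
    have hD : ∀ i, ∫⁻ z, ‖A i z - A₀ z‖ₑ ∂μT ≤ (∫⁻ ξ, ‖K i ξ - K₀ ξ‖ₑ) * ∫⁻ z, ‖uncurry f z‖ₑ ∂μT := by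
      intro i
      have hdiff := ae_kernelAverage_sub (T := T) (hKm i) hK₀m (hKb i) hK₀b (hKs i) hK₀s hfi
      have hDt : ∫⁻ ξ, ‖K i ξ - K₀ ξ‖ₑ ≠ ⊤ := by
        refine (lt_of_le_of_lt (lintegral_mono fun ξ => enorm_sub_le) ?_).ne
        rw [lintegral_add_left' (hKm i).enorm]
        exact ENNReal.add_lt_top.2 ⟨hKt i, hK₀t⟩
      calc ∫⁻ z, ‖A i z - A₀ z‖ₑ ∂μT
          = ∫⁻ z, ‖∫ ξ, (K i ξ - K₀ ξ) * f z.1 (z.2 + FunctionSpaces.Torus.proj ξ)‖ₑ ∂μT :=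
            lintegral_congr_ae (hdiff.mono fun z hz => by rw [hA, hA₀]; dsimp only; rw [hz])
        _ ≤ _ := hbound ((hKm i).sub hK₀m) hDt
    have hlim : Tendsto (fun i => (∫⁻ ξ, ‖K i ξ - K₀ ξ‖ₑ) * ∫⁻ z, ‖uncurry f z‖ₑ ∂μT) l (𝓝 0) := by
      have h2 := ENNReal.Tendsto.mul_const hKlim (b := ∫⁻ z, ‖uncurry f z‖ₑ ∂μT) (Or.inr hf1.ne)
      rwa [zero_mul] at h2
    exact tendsto_of_tendsto_of_tendsto_of_le_of_le' tendsto_const_nhds hlim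
      (Eventually.of_forall fun _ => zero_le) (Eventually.of_forall hD)
  have hL1 := tendsto_lintegral_enorm_mul_sub_of_bound (μ := μT) (W := A) (W₀ := A₀) hwb hdev
  exact tendsto_integral_of_L1 (fun z => w z * A₀ z) hI₀.aestronglyMeasurable (Eventually.of_forall hI) hL1

end Master

end Literature.Analysis.FluidPDE.Torus
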